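import Summits.MatrixMultiplication.MatrixMultiplication.Theorems.ObstructionDescentUniversalOccurrenceTwoRectangleHookTableaux

set_option linter.dupNamespace false
set_option autoImplicit false

/-!
# Universal occurrence — two rectangles, THE TYPE `(2N-8, 4, 4)`, part Y: tableau, support and the pairing lemma (decomp-mm · lens 3 · gen 43)

Route `route-MatrixMultiplication-ObstructionDescent` (sub-problem `MatrixMultiplication`, `ω(ℂ) = 2`); SUPPORT for the crux
`NoOccurrenceObstruction` (`P_O`, item `stmt-MatrixMultiplication-29040`) through the universal-occurrence programme (NODE-g29…g43
of the decomp-mm cell, lens 3).  Nothing here proves `ω = 2` or closes an item; no `def`, no `sorry`, standard axioms.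

`(2N-8,4,4)` is the first type of the two-rectangular sector with `ν₃ = 4` — outside the sub-sector `ν₃ ≤ 2` closed in part X.
Its TWO-TALL-PAIRS TABLEAU `T`: position `p < 12 ↦ (p mod 3, ⌊p/3⌋)` (four columns of height `3`), `p ≥ 12 ↦ (0, p-8)`.

* `twoTallCell_injective` / `_standard` / `twoTallCell_mem_threeRowsFour`: a standard filling of `(2N-8,4,4)` (`6 ≤ N`).
* `twoTallTableau_support`: `e_T(u) ≠ 0` ⟹ arm letters `0`, all letters `< 3`, `u` injective on every column.
* `twoTallTableau_eq_one_of_pairing` (PAIRING LEMMA): if `q ∈ C(T)` is even and fixes the arm, and `u ∘ q` is a twin word for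
  a fixed-point-free involution `π` of the four front columns (column `π(c)` repeats column `c` row by row), then `e_T(u) = 1`:
  `u ∘ q = w_T ∘ ρ` with `ρ = ρ₀ · κρ₀κ ∈ C(T)`, `ρ₀` acting on the columns `c < π(c)` and `κ` the row-wise exchange `c ↔ π(c)`,
  so `sgn ρ = 1` without any sign computation.  Both pairings `(01)(23)` and `(03)(12)` occur in part AA.

[cite: BurgisserIkenmeyer2011, §3.4 (Prop. 3.4), Thm. 4.4] [cite: BurgisserIkenmeyer2017, §5, Thm. 5.9 (proof of (2)), eq. (3.4)]
-/

noncomputable section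

open scoped BigOperators

namespace Summit.MatrixMultiplication.MatrixMultiplication.Theorems.ObstructionCalculus

open Literature.Computability.AlgebraicComplexity
open Literature.NumberTheory.DiophantineGeometry

/-! ### §1 The two-tall-pairs tableau of `(2N-8, 4, 4)` -/

/-- Cells of the two-tall-pairs tableau are distinct. [folklore] -/
theorem twoTallCell_injective {p q : ℕ}
    (hpq : (if p < 12 then (p % 3, p / 3) else (0, p - 8) : ℕ × ℕ) = (if q < 12 then (q % 3, q / 3) else (0, q - 8))) :
    p = q := by
  split_ifs at hpq <;> simp only [Prod.mk.injEq] at hpq <;> omega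

/-- The two-tall-pairs tableau is a standard filling for the position order. [folklore] -/
theorem twoTallCell_standard {p q : ℕ} (hpq : p < q) :
    ¬ ((if q < 12 then (q % 3, q / 3) else (0, q - 8) : ℕ × ℕ) ≤ (if p < 12 then (p % 3, p / 3) else (0, p - 8))) := by
  split_ifs <;> simp only [Prod.mk_le_mk] <;> omega

/-- The Young diagram of `(2N-8, 4, 4)`: its boxes. [folklore] -/
theorem mem_youngDiagram_threeRowsFour {N : ℕ} (ν : Nat.Partition (N * 2))
    (hν : ν.sortedParts = [2 * N - 8, 4, 4]) {r c : ℕ}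
    (h : (r = 0 ∧ c < 2 * N - 8) ∨ (r = 1 ∧ c < 4) ∨ (r = 2 ∧ c < 4)) :
    (r, c) ∈ ν.youngDiagram := by
  rw [Nat.Partition.mem_youngDiagram_iff, hν]
  rcases h with ⟨rfl, hc⟩ | ⟨rfl, hc⟩ | ⟨rfl, hc⟩
  · exact ⟨by simp, by simpa using hc⟩
  · exact ⟨by simp, by simpa using hc⟩
  · exact ⟨by simp, by simpa using hc⟩

/-- `(2N-8, 4, 4)` has three rows. [folklore] -/
theorem fst_lt_of_mem_youngDiagram_threeRowsFour {N : ℕ} (ν : Nat.Partition (N * 2))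
    (hν : ν.sortedParts = [2 * N - 8, 4, 4]) {x : ℕ × ℕ}
    (hx : x ∈ ν.youngDiagram.cells) : x.1 < 3 := by
  obtain ⟨h, -⟩ := (Nat.Partition.mem_youngDiagram_iff ν x).1 ((YoungDiagram.mem_cells _).1 hx)
  rw [hν] at h
  simpa using h

/-- The cells of the two-tall-pairs tableau lie in `(2N-8, 4, 4)` (`6 ≤ N`). [folklore] -/
theorem twoTallCell_mem_threeRowsFour {N : ℕ} (hN : 6 ≤ N) (ν : Nat.Partition (N * 2))
    (hν : ν.sortedParts = [2 * N - 8, 4, 4]) (p : ℕ) (hp : p < N * 2) :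
    (if p < 12 then (p % 3, p / 3) else (0, p - 8) : ℕ × ℕ) ∈ ν.youngDiagram := by
  split_ifs with h1 <;> apply mem_youngDiagram_threeRowsFour ν hν
  · have h3 : p % 3 = 0 ∨ p % 3 = 1 ∨ p % 3 = 2 := by omega
    rcases h3 with h | h | h
    · left; rw [h]; constructor <;> omega
    · right; left; rw [h]; constructor <;> omega
    · right; right; rw [h]; constructor <;> omega
  · left; constructor <;> omega

/-! ### §2 Support and the pairing lemma -/

/-- **Support of `e_T`.**  If `e_T(u) ≠ 0` then `u` vanishes on the arm, has letters `< 3`, and is injective on every column.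
[folklore] -/
theorem twoTallTableau_support {N : ℕ} {Y : YoungDiagram} (hN : ∀ x ∈ Y.cells, x.1 < N)
    (T : StdFilling (N * 2) Y)
    (hT : ∀ p : Fin (N * 2), T.1 p = (if (p : ℕ) < 12 then ((p : ℕ) % 3, (p : ℕ) / 3) else (0, (p : ℕ) - 8)))
    {u : Word N (N * 2)} (hu : T.polytabloid ℂ hN u ≠ 0) :
    (∀ p : Fin (N * 2), 12 ≤ (p : ℕ) → ((u p : Fin N) : ℕ) = 0) ∧
    (∀ p : Fin (N * 2), ((u p : Fin N) : ℕ) < 3) ∧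
    (∀ p q : Fin (N * 2), (T.1 p).2 = (T.1 q).2 → u p = u q → p = q) := by
  classical
  obtain ⟨σ, hσ, rfl⟩ := StdFilling.exists_of_polytabloid_apply_ne_zero hN T hu
  have hcol : ∀ p, (T.1 (σ p)).2 = (T.1 p).2 := StdFilling.mem_colStab.1 hσ
  have hval : ∀ p, ((StdFilling.rowWord hN T ∘ ⇑σ) p : ℕ) = (T.1 (σ p)).1 := fun p => rfl
  have hrow' : ∀ q : Fin (N * 2), (T.1 q).1 = if (q : ℕ) < 12 then (q : ℕ) % 3 else 0 := fun q => by
    rw [hT]; split_ifs <;> rfl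
  have hcol' : ∀ q : Fin (N * 2), (T.1 q).2 = if (q : ℕ) < 12 then (q : ℕ) / 3 else (q : ℕ) - 8 :=
    fun q => by rw [hT]; split_ifs <;> rfl
  refine ⟨fun p hp => ?_, fun p => ?_, fun p q hpq hupq => ?_⟩
  · have hc := hcol p
    rw [hcol', hcol'] at hc
    rw [hval, hrow']
    split_ifs at hc ⊢ <;> omega
  · rw [hval, hrow']
    split_ifs <;> omega
  · have hr : (T.1 (σ p)).1 = (T.1 (σ q)).1 := by
      rw [← hval, ← hval]; exact congrArg Fin.val hupq
    have hc : (T.1 (σ p)).2 = (T.1 (σ q)).2 := by rw [hcol, hcol, hpq]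
    exact σ.injective (T.injective (Prod.ext hr hc))

set_option maxHeartbeats 400000 in
/-- **Pairing lemma.**  Let `q ∈ C(T)` be even and fix the arm, and let `π` be a fixed-point-free involution of the four front
columns.  If `e_T`'s support conditions hold for `u` and `u ∘ q` is a `π`-twin word (column `π(c)` repeats column `c` row by
row), then `e_T(u) = 1`. [folklore] -/
theorem twoTallTableau_eq_one_of_pairing {N : ℕ} {Y : YoungDiagram} (hN : ∀ x ∈ Y.cells, x.1 < N)
    (T : StdFilling (N * 2) Y)
    (hT : ∀ p : Fin (N * 2), T.1 p = (if (p : ℕ) < 12 then ((p : ℕ) % 3, (p : ℕ) / 3) else (0, (p : ℕ) - 8)))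
    (h12 : 12 ≤ N * 2) {u : Word N (N * 2)}
    (harm : ∀ p : Fin (N * 2), 12 ≤ (p : ℕ) → ((u p : Fin N) : ℕ) = 0)
    (hlt3 : ∀ p : Fin (N * 2), ((u p : Fin N) : ℕ) < 3)
    (hinj : ∀ p q : Fin (N * 2), (T.1 p).2 = (T.1 q).2 → u p = u q → p = q)
    (q : Equiv.Perm (Fin (N * 2))) (hqC : q ∈ T.colStab) (hqs : Equiv.Perm.sign q = 1)
    (hqarm : ∀ p : Fin (N * 2), 12 ≤ (p : ℕ) → q p = p)
    (π : ℕ → ℕ) (hπlt : ∀ c, c < 4 → π c < 4) (hπi : ∀ c, c < 4 → π (π c) = c) (hπne : ∀ c, c < 4 → π c ≠ c)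
    (htwin : ∀ (p : Fin (N * 2)) (hp : (p : ℕ) < 12),
      u (q ⟨3 * π ((p : ℕ) / 3) + (p : ℕ) % 3, by have := hπlt ((p : ℕ) / 3) (by omega); omega⟩) = u (q p)) :
    T.polytabloid ℂ hN u = 1 := by
  classical
  have hrow' : ∀ x : Fin (N * 2), (T.1 x).1 = if (x : ℕ) < 12 then (x : ℕ) % 3 else 0 := fun x => by
    rw [hT]; split_ifs <;> rfl
  have hcol' : ∀ x : Fin (N * 2), (T.1 x).2 = if (x : ℕ) < 12 then (x : ℕ) / 3 else (x : ℕ) - 8 :=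
    fun x => by rw [hT]; split_ifs <;> rfl
  -- the word `u' = u ∘ q` satisfies the support conditions too
  set u' : Word N (N * 2) := u ∘ ⇑q with hu'
  have hqcol : ∀ p, (T.1 (q p)).2 = (T.1 p).2 := StdFilling.mem_colStab.1 hqC
  have harm' : ∀ p : Fin (N * 2), 12 ≤ (p : ℕ) → ((u' p : Fin N) : ℕ) = 0 := fun p hp => by
    show ((u (q p) : Fin N) : ℕ) = 0; rw [hqarm p hp]; exact harm p hp
  have hlt3' : ∀ p : Fin (N * 2), ((u' p : Fin N) : ℕ) < 3 := fun p => hlt3 _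
  have hinj' : ∀ p p' : Fin (N * 2), (p : ℕ) < 12 → (p' : ℕ) < 12 → (p : ℕ) / 3 = (p' : ℕ) / 3 → u' p = u' p' → p = p' := by
    intro p p' hp hp' hc h
    have h1 : (T.1 (q p)).2 = (T.1 (q p')).2 := by
      rw [hqcol, hqcol, hcol', hcol', if_pos hp, if_pos hp', hc]
    exact q.injective (hinj _ _ h1 h)
  have htwin' : ∀ (p : Fin (N * 2)) (hp : (p : ℕ) < 12),
      ((u' ⟨3 * π ((p : ℕ) / 3) + (p : ℕ) % 3, by have := hπlt ((p : ℕ) / 3) (by omega); omega⟩ : Fin N) : ℕ) =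
        ((u' p : Fin N) : ℕ) := fun p hp => congrArg Fin.val (htwin p hp)
  -- `ρ₀`: the permutation of the columns `c < π c` realising `u'` there
  let S := {p : Fin (N * 2) // (p : ℕ) < 12 ∧ (p : ℕ) / 3 < π ((p : ℕ) / 3)}
  have hb : ∀ x : S, 3 * (((x.1 : Fin (N * 2)) : ℕ) / 3) + ((u' x.1 : Fin N) : ℕ) < N * 2 := by
    intro x; have := hlt3' x.1; have := x.2; omega
  let f₀ : S → S := fun x =>
    ⟨⟨3 * (((x.1 : Fin (N * 2)) : ℕ) / 3) + ((u' x.1 : Fin N) : ℕ), hb x⟩, by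
      have h3 := hlt3' x.1; obtain ⟨h1, h2⟩ := x.2
      refine ⟨by simp only; omega, ?_⟩
      simp only
      rw [show (3 * ((((x.1 : Fin (N * 2)) : ℕ)) / 3) + ((u' x.1 : Fin N) : ℕ)) / 3 = ((x.1 : Fin (N * 2)) : ℕ) / 3 by omega]
      exact h2⟩
  have hf₀v : ∀ x : S, (((f₀ x).1 : Fin (N * 2)) : ℕ) =
      3 * (((x.1 : Fin (N * 2)) : ℕ) / 3) + ((u' x.1 : Fin N) : ℕ) := fun x => rfl
  have hf₀ : Function.Injective f₀ := by
    rintro ⟨p, hp⟩ ⟨p', hp'⟩ hpp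
    have h1 := congrArg (fun x : S => ((x.1 : Fin (N * 2)) : ℕ)) hpp
    simp only [hf₀v] at h1
    apply Subtype.ext
    have hup := hlt3' p
    have hup' := hlt3' p'
    exact hinj' p p' hp.1 hp'.1 (by omega) (Fin.ext (by omega))
  let F₀ : Equiv.Perm S := Equiv.ofBijective f₀ (Finite.injective_iff_bijective.1 hf₀)
  let ρ₀ : Equiv.Perm (Fin (N * 2)) := Equiv.Perm.ofSubtype F₀
  have hρ₀S : ∀ (p : Fin (N * 2)) (hp : (p : ℕ) < 12 ∧ (p : ℕ) / 3 < π ((p : ℕ) / 3)),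
      ((ρ₀ p : Fin (N * 2)) : ℕ) = 3 * ((p : ℕ) / 3) + ((u' p : Fin N) : ℕ) := by
    intro p hp
    show ((Equiv.Perm.ofSubtype F₀ p : Fin (N * 2)) : ℕ) = _
    rw [Equiv.Perm.ofSubtype_apply_of_mem F₀ hp]
    exact hf₀v ⟨p, hp⟩
  have hρ₀_fix : ∀ p : Fin (N * 2), ¬ ((p : ℕ) < 12 ∧ (p : ℕ) / 3 < π ((p : ℕ) / 3)) → ρ₀ p = p := fun p hp =>
    Equiv.Perm.ofSubtype_apply_of_not_mem F₀ hp
  -- `κ`: the row-wise exchange of the columns `c ↔ π c`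
  let kf : Fin (N * 2) → Fin (N * 2) := fun p =>
    if h : (p : ℕ) < 12 then ⟨3 * π ((p : ℕ) / 3) + (p : ℕ) % 3, by have := hπlt ((p : ℕ) / 3) (by omega); omega⟩
    else p
  have hkf : ∀ p, ((kf p : Fin (N * 2)) : ℕ) = if (p : ℕ) < 12 then 3 * π ((p : ℕ) / 3) + (p : ℕ) % 3 else p := by
    intro p; simp only [kf]; split_ifs <;> rfl
  have hkι : Function.Involutive kf := by
    intro p
    apply Fin.ext
    by_cases hp : (p : ℕ) < 12
    · have h1 : ((kf p : Fin (N * 2)) : ℕ) = 3 * π ((p : ℕ) / 3) + (p : ℕ) % 3 := by rw [hkf, if_pos hp]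
      have hc := hπlt ((p : ℕ) / 3) (by omega)
      have hi := hπi ((p : ℕ) / 3) (by omega)
      have h2 : ((kf p : Fin (N * 2)) : ℕ) / 3 = π ((p : ℕ) / 3) := by rw [h1]; omega
      have h3 : ((kf p : Fin (N * 2)) : ℕ) % 3 = (p : ℕ) % 3 := by rw [h1]; omega
      rw [hkf, if_pos (by rw [h1]; omega), h2, hi, h3]
      omega
    · have h1 : kf p = p := Fin.ext (by rw [hkf, if_neg hp])
      rw [h1, h1]
  let κ : Equiv.Perm (Fin (N * 2)) := Function.Involutive.toPerm kf hkι
  have hκ : ∀ p, ((κ p : Fin (N * 2)) : ℕ) = if (p : ℕ) < 12 then 3 * π ((p : ℕ) / 3) + (p : ℕ) % 3 else p := hkf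
  let ρ : Equiv.Perm (Fin (N * 2)) := ρ₀ * (κ * ρ₀ * κ)
  have hρ : ∀ p, ρ p = ρ₀ (κ (ρ₀ (κ p))) := fun p => rfl
  -- values of `ρ`: `ρ p = 3 ⌊p/3⌋ + u'(p)` on the front, identity on the arm
  have hρ_front : ∀ p : Fin (N * 2), (p : ℕ) < 12 → ((ρ p : Fin (N * 2)) : ℕ) = 3 * ((p : ℕ) / 3) + ((u' p : Fin N) : ℕ) := by
    intro p hp
    have hc := hπlt ((p : ℕ) / 3) (by omega)
    have hi := hπi ((p : ℕ) / 3) (by omega)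
    have hne := hπne ((p : ℕ) / 3) (by omega)
    have h1 : ((κ p : Fin (N * 2)) : ℕ) = 3 * π ((p : ℕ) / 3) + (p : ℕ) % 3 := by rw [hκ, if_pos hp]
    have h1c : ((κ p : Fin (N * 2)) : ℕ) / 3 = π ((p : ℕ) / 3) := by rw [h1]; omega
    by_cases hS : (p : ℕ) / 3 < π ((p : ℕ) / 3)
    · have h2 : ρ₀ (κ p) = κ p := hρ₀_fix _ (fun h => by rw [h1c, hi] at h; omega)
      have h3 : κ (κ p) = p := hkι p
      rw [hρ, h2, h3]
      exact hρ₀S p ⟨hp, hS⟩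
    · have hu3 := hlt3' (κ p)
      have h2 : ((ρ₀ (κ p) : Fin (N * 2)) : ℕ) = 3 * π ((p : ℕ) / 3) + ((u' (κ p) : Fin N) : ℕ) := by
        rw [hρ₀S _ ⟨by rw [h1]; omega, by rw [h1c, hi]; omega⟩, h1c]
      have htw : ((u' (κ p) : Fin N) : ℕ) = ((u' p : Fin N) : ℕ) := by
        rw [← htwin' p hp]; congr 2; exact Fin.ext h1
      have h3 : ((κ (ρ₀ (κ p)) : Fin (N * 2)) : ℕ) = 3 * ((p : ℕ) / 3) + ((u' p : Fin N) : ℕ) := by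
        rw [hκ, if_pos (by rw [h2]; omega), h2,
          show (3 * π ((p : ℕ) / 3) + ((u' (κ p) : Fin N) : ℕ)) / 3 = π ((p : ℕ) / 3) by omega, hi,
          show (3 * π ((p : ℕ) / 3) + ((u' (κ p) : Fin N) : ℕ)) % 3 = ((u' (κ p) : Fin N) : ℕ) by omega, htw]
      have hu3p := hlt3' p
      have h4 : ρ₀ (κ (ρ₀ (κ p))) = κ (ρ₀ (κ p)) := hρ₀_fix _ (fun h => by
        rw [h3, show (3 * ((p : ℕ) / 3) + ((u' p : Fin N) : ℕ)) / 3 = (p : ℕ) / 3 by omega] at h; exact hS h.2)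
      rw [hρ, h4, h3]
  have hρ_ge : ∀ p : Fin (N * 2), 12 ≤ (p : ℕ) → ρ p = p := by
    intro p hp
    have h1 : κ p = p := Fin.ext (by rw [hκ, if_neg (by omega)])
    have h2 : ρ₀ p = p := hρ₀_fix _ (by omega)
    rw [hρ, h1, h2, h1, h2]
  -- `ρ` is a column permutation and `u' = w_T ∘ ρ`
  have hρC : ρ ∈ T.colStab := by
    rw [StdFilling.mem_colStab]
    intro p
    rw [hcol', hcol']
    by_cases hp : (p : ℕ) < 12
    · have e1 := hρ_front p hp
      have := hlt3' p
      rw [if_pos (by omega), if_pos hp, e1]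
      omega
    · rw [hρ_ge p (by omega)]
  have hw : u' = StdFilling.rowWord hN T ∘ ⇑ρ := by
    funext p
    apply Fin.ext
    show ((u' p : Fin N) : ℕ) = (T.1 (ρ p)).1
    rw [hrow']
    by_cases hp : (p : ℕ) < 12
    · have e1 := hρ_front p hp
      have := hlt3' p
      rw [if_pos (by omega), e1]
      omega
    · rw [hρ_ge p (by omega), if_neg hp]
      exact harm' p (by omega)
  have key := congrFun (StdFilling.wordPerm_polytabloid_of_mem_colStab (k := ℂ) hN T hρC)
    (StdFilling.rowWord hN T)
  rw [wordPerm_apply, ← hw, Pi.smul_apply, StdFilling.polytabloid_apply_rowWord, smul_eq_mul,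
    mul_one] at key
  have hs : Equiv.Perm.sign ρ = 1 := by
    show Equiv.Perm.sign (ρ₀ * (κ * ρ₀ * κ)) = 1
    simp only [Equiv.Perm.sign_mul]
    rcases Int.units_eq_one_or (Equiv.Perm.sign ρ₀) with h1 | h1 <;>
    rcases Int.units_eq_one_or (Equiv.Perm.sign κ) with h2 | h2 <;> simp [h1, h2]
  have h1 : T.polytabloid ℂ hN u' = 1 := by rw [key, hs]; simp
  -- `e_T(u ∘ q) = sgn(q) · e_T(u)`
  have key2 := congrFun (StdFilling.wordPerm_polytabloid_of_mem_colStab (k := ℂ) hN T hqC) u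
  rw [wordPerm_apply, Pi.smul_apply, smul_eq_mul, hqs] at key2
  rw [hu'] at h1
  rw [h1] at key2
  simpa using key2.symm

end Summit.MatrixMultiplication.MatrixMultiplication.Theorems.ObstructionCalculus
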